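import Summits.KontsevichZagierPeriods.KontsevichZagierPeriods.Theorems.RootDecompWalshStrataCutBall4PairBase

/-!
# Root decomposition on Walsh strata — part 109 (gen 13, addendum 1): the pairwise-overlap chart

Crux `QuadricSignKernel` (item 25393), slice `d = 4`; notation of parts 104–108.  The chart
`Φ₂(y₀, y₁, u₀, u₁) = (1 + y₀, 1 + y₁, s·u₀, s·u₁)`, `s = √(ρ − (1+y₀)² − (1+y₁)²)`, carries the
source `src2Rep ρ q = t2Rep ρ q × [unit quarter disc, 1]` (part 108) onto the pairwise cap overlap
`[K_{01}(ρ), q]`: lower block-triangular Jacobian with `det Φ₂' = s²`, matching the source weight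
`q·(ρ − (1+y₀)² − (1+y₁)²)`.  Main statement: `of_src2Rep_sub_of_pairRep_mem_relations` —
`[src2Rep ρ q] − [K_{01}(ρ), q] ∈ KZ.relations` for `ρ ≤ 3` (Kontsevich–Zagier's rule (2)); the
proof is the one of part 105 with the second base coordinate translated as well.
[KontsevichZagier2001 §1.2 rule (2), §4.1; BCR1998 §2.2]
-/

noncomputable section

open Literature.NumberTheory.Transcendental
open MeasureTheory Set
open MvPolynomial (aeval X C)
open Literature.ModelTheory.ExponentialFields (IsSemialgebraic)
open Summit.KontsevichZagierPeriods.RootDecompWalshStrata.WalshSpanProof (cellRep cellRep_domain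
  cellRep_integrand)
open Summit.KontsevichZagierPeriods.RootDecompWalshStrata.ConeSpecimen (discPoly aeval_discPoly)

namespace Summit.KontsevichZagierPeriods.RootDecompWalshStrata.CutBall4

variable {ρ : ℚ}

/-! #### The chart `Φ₂(y₀, y₁, u₀, u₁) = (1 + y₀, 1 + y₁, s·u₀, s·u₁)` -/

/-- The fibre radius squared of the overlap, read in the source coordinates. -/
def gP (ρ : ℚ) (z : Fin 4 → ℝ) : ℝ := (ρ : ℝ) - (1 + z 0) ^ 2 - (1 + z 1) ^ 2

/-- The fibre radius `s = √g₂`. -/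
def sP (ρ : ℚ) (z : Fin 4 → ℝ) : ℝ := √(gP ρ z)

/-- `s² = g₂` where `g₂ ≥ 0`. [folklore] -/
theorem sP_sq {z : Fin 4 → ℝ} (hz : 0 ≤ gP ρ z) : sP ρ z ^ 2 = gP ρ z := Real.sq_sqrt hz

/-- `s > 0` where `g₂ > 0`. [folklore] -/
theorem sP_pos {z : Fin 4 → ℝ} (hz : 0 < gP ρ z) : 0 < sP ρ z := Real.sqrt_pos.2 hz

/-- The overlap chart. -/
def phiP (ρ : ℚ) (z : Fin 4 → ℝ) : Fin 4 → ℝ := ![1 + z 0, 1 + z 1, sP ρ z * z 2, sP ρ z * z 3]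

/-- Component `0` of the chart: `x₀ = 1 + y₀`. [definition] -/
@[simp] theorem phiP_zero (z : Fin 4 → ℝ) : phiP ρ z 0 = 1 + z 0 := rfl

/-- Component `1` of the chart: `x₁ = 1 + y₁`. [definition] -/
@[simp] theorem phiP_one (z : Fin 4 → ℝ) : phiP ρ z 1 = 1 + z 1 := rfl

/-- Component `2` of the chart: `x₂ = s·u₀`. [definition] -/
@[simp] theorem phiP_two (z : Fin 4 → ℝ) : phiP ρ z 2 = sP ρ z * z 2 := rfl

/-- Component `3` of the chart: `x₃ = s·u₁`. [definition] -/
@[simp] theorem phiP_three (z : Fin 4 → ℝ) : phiP ρ z 3 = sP ρ z * z 3 := rfl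

/-- The Jacobian matrix of `Φ₂` (lower block-triangular; `∂s/∂yᵢ = −(1+yᵢ)/s`). -/
def phiPMat (ρ : ℚ) (z : Fin 4 → ℝ) : Matrix (Fin 4) (Fin 4) ℝ :=
  !![1, 0, 0, 0;
     0, 1, 0, 0;
     -(1 + z 0) / sP ρ z * z 2, -(1 + z 1) / sP ρ z * z 2, sP ρ z, 0;
     -(1 + z 0) / sP ρ z * z 3, -(1 + z 1) / sP ρ z * z 3, 0, sP ρ z]

/-- The derivative of `Φ₂` as a continuous linear map. -/
def phiP' (ρ : ℚ) (z : Fin 4 → ℝ) : (Fin 4 → ℝ) →L[ℝ] (Fin 4 → ℝ) :=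
  LinearMap.toContinuousLinearMap (Matrix.toLin' (phiPMat ρ z))

/-- `Φ₂'(z)` acts by the Jacobian matrix. [calculus] -/
theorem phiP'_apply (z v : Fin 4 → ℝ) (a : Fin 4) : phiP' ρ z v a = ∑ b, phiPMat ρ z a b * v b := by
  change Matrix.toLin' (phiPMat ρ z) v a = _
  rw [Matrix.toLin'_apply]
  rfl

/-- `det Φ₂'(z) = s²`. [calculus] -/
theorem phiP'_det (z : Fin 4 → ℝ) : (phiP' ρ z).det = sP ρ z ^ 2 := by
  change LinearMap.det (Matrix.toLin' (phiPMat ρ z)) = _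
  rw [LinearMap.det_toLin', phiPMat, Matrix.det_succ_row_zero]
  simp [Fin.sum_univ_succ, Matrix.det_fin_three]
  ring

/-- `Φ₂` is differentiable where `g₂ > 0`, with derivative `Φ₂'`. [calculus] -/
theorem hasFDerivAt_phiP (z : Fin 4 → ℝ) (hz : 0 < gP ρ z) : HasFDerivAt (phiP ρ) (phiP' ρ z) z := by
  have hs0 : sP ρ z ≠ 0 := (sP_pos hz).ne'
  have hπ0 : HasFDerivAt (fun y : Fin 4 → ℝ => y 0)
      (ContinuousLinearMap.proj (R := ℝ) (φ := fun _ : Fin 4 => ℝ) 0) z := hasFDerivAt_apply 0 z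
  have hπ1 : HasFDerivAt (fun y : Fin 4 → ℝ => y 1)
      (ContinuousLinearMap.proj (R := ℝ) (φ := fun _ : Fin 4 => ℝ) 1) z := hasFDerivAt_apply 1 z
  have hA1 : HasDerivAt (fun t : ℝ => (1 + t) ^ 2) (2 * (1 + z 0)) (z 0) := by
    simpa using HasDerivAt.comp_const_add 1 (z 0) (hasDerivAt_pow 2 (1 + z 0))
  have hA : HasFDerivAt (fun y : Fin 4 → ℝ => (1 + y 0) ^ 2)
      ((2 * (1 + z 0)) • ContinuousLinearMap.proj (R := ℝ) (φ := fun _ : Fin 4 => ℝ) 0) z :=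
    HasDerivAt.comp_hasFDerivAt (h₂ := fun t : ℝ => (1 + t) ^ 2) z hA1 hπ0
  have hB1 : HasDerivAt (fun t : ℝ => (1 + t) ^ 2) (2 * (1 + z 1)) (z 1) := by
    simpa using HasDerivAt.comp_const_add 1 (z 1) (hasDerivAt_pow 2 (1 + z 1))
  have hB : HasFDerivAt (fun y : Fin 4 → ℝ => (1 + y 1) ^ 2)
      ((2 * (1 + z 1)) • ContinuousLinearMap.proj (R := ℝ) (φ := fun _ : Fin 4 => ℝ) 1) z :=
    HasDerivAt.comp_hasFDerivAt (h₂ := fun t : ℝ => (1 + t) ^ 2) z hB1 hπ1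
  have hg : HasFDerivAt (gP ρ)
      (0 - (2 * (1 + z 0)) • ContinuousLinearMap.proj (R := ℝ) (φ := fun _ : Fin 4 => ℝ) 0 -
        (2 * (1 + z 1)) • ContinuousLinearMap.proj (R := ℝ) (φ := fun _ : Fin 4 => ℝ) 1) z :=
    ((hasFDerivAt_const (𝕜 := ℝ) (ρ : ℝ) z).sub hA).sub hB
  have hs : HasFDerivAt (sP ρ) ((1 / (2 * √(gP ρ z))) •
      (0 - (2 * (1 + z 0)) • ContinuousLinearMap.proj (R := ℝ) (φ := fun _ : Fin 4 => ℝ) 0 -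
        (2 * (1 + z 1)) • ContinuousLinearMap.proj (R := ℝ) (φ := fun _ : Fin 4 => ℝ) 1)) z :=
    HasDerivAt.comp_hasFDerivAt (h₂ := Real.sqrt) z (Real.hasDerivAt_sqrt hz.ne') hg
  have hroot : √(gP ρ z) = sP ρ z := rfl
  rw [hroot] at hs
  have h0 : HasFDerivAt (fun y : Fin 4 → ℝ => phiP ρ y 0)
      ((ContinuousLinearMap.proj 0).comp (phiP' ρ z)) z := by
    have hf : (fun y : Fin 4 → ℝ => phiP ρ y 0) = fun y => 1 + y 0 := funext phiP_zero
    rw [hf]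
    refine (hπ0.const_add 1).congr_fderiv (ContinuousLinearMap.ext fun v => ?_)
    simp [phiP'_apply, phiPMat, Fin.sum_univ_four]
  have h1 : HasFDerivAt (fun y : Fin 4 → ℝ => phiP ρ y 1)
      ((ContinuousLinearMap.proj 1).comp (phiP' ρ z)) z := by
    have hf : (fun y : Fin 4 → ℝ => phiP ρ y 1) = fun y => 1 + y 1 := funext phiP_one
    rw [hf]
    refine (hπ1.const_add 1).congr_fderiv (ContinuousLinearMap.ext fun v => ?_)
    simp [phiP'_apply, phiPMat, Fin.sum_univ_four]
  have h2 : HasFDerivAt (fun y : Fin 4 → ℝ => phiP ρ y 2)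
      ((ContinuousLinearMap.proj 2).comp (phiP' ρ z)) z := by
    have hf : (fun y : Fin 4 → ℝ => phiP ρ y 2) = fun y => sP ρ y * y 2 := funext phiP_two
    rw [hf]
    refine (hs.mul (hasFDerivAt_apply 2 z)).congr_fderiv (ContinuousLinearMap.ext fun v => ?_)
    simp [phiP'_apply, phiPMat, Fin.sum_univ_four]
    field_simp
    ring
  have h3 : HasFDerivAt (fun y : Fin 4 → ℝ => phiP ρ y 3)
      ((ContinuousLinearMap.proj 3).comp (phiP' ρ z)) z := by
    have hf : (fun y : Fin 4 → ℝ => phiP ρ y 3) = fun y => sP ρ y * y 3 := funext phiP_three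
    rw [hf]
    refine (hs.mul (hasFDerivAt_apply 3 z)).congr_fderiv (ContinuousLinearMap.ext fun v => ?_)
    simp [phiP'_apply, phiPMat, Fin.sum_univ_four]
    field_simp
    ring
  refine hasFDerivAt_pi'' fun a => ?_
  fin_cases a
  · exact h0
  · exact h1
  · exact h2
  · exact h3

/-- `Φ₂` is injective where `g₂ > 0`. [calculus] -/
theorem injOn_phiP : InjOn (phiP ρ) {z | 0 < gP ρ z} := by
  intro x hx y _ hxy
  have e0 : 1 + x 0 = 1 + y 0 := by simpa using congrFun hxy 0
  have e1 : 1 + x 1 = 1 + y 1 := by simpa using congrFun hxy 1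
  have e2 : sP ρ x * x 2 = sP ρ y * y 2 := by simpa using congrFun hxy 2
  have e3 : sP ρ x * x 3 = sP ρ y * y 3 := by simpa using congrFun hxy 3
  have h0 : x 0 = y 0 := by linarith
  have h1 : x 1 = y 1 := by linarith
  have hs : sP ρ x = sP ρ y := by simp only [sP, gP, h0, h1]
  have hs0 : sP ρ x ≠ 0 := (sP_pos hx).ne'
  rw [← hs] at e2 e3
  funext a
  fin_cases a
  · exact h0
  · exact h1
  · exact mul_left_cancel₀ hs0 e2
  · exact mul_left_cancel₀ hs0 e3

/-- `Φ₂` is a `ℚ`-semialgebraic map on every `ℚ`-semialgebraic set. [BCR1998 §2.2] -/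
theorem isSemialgebraicMapOn_phiP {S : Set (Fin 4 → ℝ)} (hS : IsSemialgebraic ℚ S) :
    IsSemialgebraicMapOn ℚ S (phiP ρ) := by
  have hsP : IsSemialgebraicFunOn ℚ S (sP ρ) :=
    (IsSemialgebraicFunOn.sqrt_holds (isSemialgebraicFunOn_aeval hS
      (C ρ - (1 + X 0) ^ 2 - (1 + X 1) ^ 2 : MvPolynomial (Fin 4) ℚ))).congr fun z _ => by
        simp only [sP, gP, map_sub, map_add, map_pow, map_one, MvPolynomial.aeval_X,
          MvPolynomial.aeval_C, eq_ratCast]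
  refine IsSemialgebraicMapOn.of_forall hS fun j => ?_
  fin_cases j
  · exact (isSemialgebraicFunOn_aeval hS (1 + X 0 : MvPolynomial (Fin 4) ℚ)).congr fun z _ => by simp
  · exact (isSemialgebraicFunOn_aeval hS (1 + X 1 : MvPolynomial (Fin 4) ℚ)).congr fun z _ => by simp
  · exact (hsP.mul_holds (isSemialgebraicFunOn_apply hS 2)).congr fun z _ => by simp
  · exact (hsP.mul_holds (isSemialgebraicFunOn_apply hS 3)).congr fun z _ => by simp

/-- **`Φ₂` maps the source onto the overlap `K_{01}(ρ)`** (inverse: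
`z = (x₀ − 1, x₁ − 1, x₂/s, x₃/s)`, `s = √(ρ − x₀² − x₁²)`). [calculus] -/
theorem image_phiP (q : ℚ) (h3 : ρ ≤ 3) : phiP ρ '' (src2Rep ρ q h3).domain = pairSet ρ 0 1 := by
  ext x
  simp only [mem_image, mem_pairSet]
  constructor
  · rintro ⟨z, hz, rfl⟩
    rw [mem_src2_iff] at hz
    obtain ⟨⟨h0, h1, hr⟩, ⟨⟨h2a, h2b⟩, ⟨h3a, h3b⟩⟩, hd⟩ := hz
    have hg : 0 < gP ρ z := by rw [gP]; linarith
    have hs := sP_pos hg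
    have hsq := sP_sq hg.le
    refine ⟨fun j => ?_, ⟨by simp; linarith, by simp; linarith⟩, ?_⟩
    · fin_cases j
      · simp; linarith
      · simp; linarith
      · simpa using mul_pos hs h2a
      · simpa using mul_pos hs h3a
    · rw [nsq, phiP_zero, phiP_one, phiP_two, phiP_three]
      rw [gP] at hsq
      nlinarith [mul_pos hs h2a, mul_pos hs h3a]
  · rintro ⟨hpos, ⟨hx0, hx1⟩, hn⟩
    rw [nsq] at hn
    have hx2 := hpos 2; have hx3 := hpos 3
    have hg : 0 < (ρ : ℝ) - x 0 ^ 2 - x 1 ^ 2 := by nlinarith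
    set s : ℝ := √((ρ : ℝ) - x 0 ^ 2 - x 1 ^ 2) with hs_def
    have hs : 0 < s := Real.sqrt_pos.2 hg
    have hsq : s ^ 2 = (ρ : ℝ) - x 0 ^ 2 - x 1 ^ 2 := Real.sq_sqrt hg.le
    have hsP : ∀ z : Fin 4 → ℝ, z 0 = x 0 - 1 → z 1 = x 1 - 1 → sP ρ z = s := by
      intro z hz0 hz1
      rw [sP, gP, hz0, hz1, hs_def]
      ring_nf
    refine ⟨![x 0 - 1, x 1 - 1, x 2 / s, x 3 / s], ?_, ?_⟩
    · rw [mem_src2_iff]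
      simp only [Matrix.cons_val_zero, Matrix.cons_val_one, Matrix.cons_val]
      have h2s : x 2 < s := by nlinarith
      have h3s : x 3 < s := by nlinarith
      refine ⟨⟨by linarith, by linarith, by nlinarith⟩, ⟨⟨div_pos hx2 hs, (div_lt_one hs).2 h2s⟩,
        ⟨div_pos hx3 hs, (div_lt_one hs).2 h3s⟩⟩, ?_⟩
      rw [div_pow, div_pow, ← add_div, div_lt_one (by positivity), hsq]
      linarith
    · have hsz : sP ρ ![x 0 - 1, x 1 - 1, x 2 / s, x 3 / s] = s := hsP _ rfl rfl
      funext a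
      fin_cases a
      · simp
      · simp
      · simp only [Fin.reduceFinMk, phiP_two, Matrix.cons_val, hsz]
        field_simp
      · simp only [Fin.reduceFinMk, phiP_three, Matrix.cons_val, hsz]
        field_simp

/-! #### Move (2): `[t2Rep × quarter disc] − [K_{01}(ρ), q]` is a change of variables along `Φ₂` -/

/-- **Move (2), the overlap chart:** `[t2Rep ρ q × unit quarter disc] − [K_{01}(ρ), q] ∈ KZ.relations`
(`|det Φ₂'| = s² = ρ − (1+y₀)² − (1+y₁)²`, matching the source weight), `ρ ≤ 3`.
[KontsevichZagier2001 §1.2 rule (2)] -/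
theorem of_src2Rep_sub_of_pairRep_mem_relations (q : ℚ) (h3 : ρ ≤ 3) :
    KZ.of (src2Rep ρ q h3) - KZ.of (pairRep ρ q (le_four_of_le_three h3) 0 1) ∈ KZ.relations := by
  have hgdom : ∀ z ∈ (src2Rep ρ q h3).domain, 0 < gP ρ z := fun z hz => by
    rw [mem_src2_iff] at hz
    rw [gP]; linarith [hz.1.2.2]
  refine KZ.changeOfVariablesRel_subset_relations
    ⟨2 + 2, src2Rep ρ q h3, pairRep ρ q (le_four_of_le_three h3) 0 1, phiP ρ, phiP' ρ,
      isSemialgebraicMapOn_phiP (src2Rep ρ q h3).isSemialgebraic_domain,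
      fun z hz => (hasFDerivAt_phiP z (hgdom z hz)).hasFDerivWithinAt,
      injOn_phiP.mono hgdom, ?_, fun z hz => ?_, rfl⟩
  · exact (pairRep_domain q _ 0 1).trans (image_phiP q h3).symm
  · rw [src2Rep_integrand, pairRep_integrand, phiP'_det, abs_of_nonneg (sq_nonneg _),
      sP_sq (hgdom z hz).le, gP]

end Summit.KontsevichZagierPeriods.RootDecompWalshStrata.CutBall4

end
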